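import Summits.Ventures.LatticeQCDFlow.Scoring.TorusAreaLaw2DHigherRep
import HarnessLib

/-!
# The exact non-abelian area law in two dimensions, V-g: THE FLUX LOOPS `Re (det W)^q`, `q ≠ 0`, OF TWO-DIMENSIONAL `U(N)` LATTICE YANG–MILLS OBEY THE VOLUME-UNIFORM AREA LAW AT EVERY COUPLING

HONEST FRAMING: exact (Metropolis-corrected) sampling algorithms for lattice gauge theory;
figures of merit are autocorrelation/cost numbers at stated couplings and volumes; no
continuum-physics claim.

Venture `LatticeQCDFlow` (cell pub-lqcd), sub-topic `Scoring`; FANOUT row 5 (`s0-sun-a`), GEN-18.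
NEW WORK of the cell (placement rule).  Part V-f (`TorusAreaLaw2DHigherRep.areaLaw_two_of_rep_card_eq_one`) gives
the volume-uniform torus area law for the loops of any non-trivial continuous character `σ` in any `ρ`-Wilson-action
theory.  The flux characters `σ_q(u) = (det u)^q` of `U(N)` (`NonabelianAreaLaw2DFluxLoops`; GEN-17 `UNFluxSectors`)
are non-trivial exactly when `q ≠ 0` — witnessed by the central element `e^{iπ/(Nq)}·1`, of determinant power
`e^{iπ} = −1`:

* `smul_one_mem_unitaryGroup`, `det_zpow_smul_one` — the scalar unitary `e^{iθ}·1 ∈ U(N)` and `(det(c·1))^q = c^{Nq}`;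
* **`unitary_fluxLoop_areaLaw`** — for every `N ≥ 1`, `q ≠ 0`, every continuous realisation `σ` of `(det)^q` and
  every real `β` there are `C`, `c_area > 0` with
  `|⟨Re (det W_{R×T})^q⟩_{U(N),(ℤ/L)²,β}| ≤ C^{2(R+T)} e^{−c_area RT}` for all `L`, both planes, all base points and
  all `1 ≤ R, T ≤ L/2` (the `q = 0` loop is the constant `1`).

No `def`, nothing cited as a fact, 0 sorry.
-/

noncomputable section

open MeasureTheory Function Finset
open Literature.MathematicalPhysics.QuantumFieldTheory
open Literature.MathematicalPhysics.QuantumLattice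
open Summit.Ventures.LatticeQCDFlow.Theory2.Lattice
open Summit.Ventures.LatticeQCDFlow.Theory2.Lattice.TwoDim

namespace Summit.Ventures.LatticeQCDFlow.Scoring

/-- A unit complex scalar times the identity is unitary. -/
theorem smul_one_mem_unitaryGroup (N : ℕ) {c : ℂ} (hc : ‖c‖ = 1) :
    c • (1 : Matrix (Fin N) (Fin N) ℂ) ∈ Matrix.unitaryGroup (Fin N) ℂ := by
  rw [Matrix.mem_unitaryGroup_iff, star_smul, star_one, Matrix.smul_mul, Matrix.one_mul, smul_smul,
    Complex.star_def, Complex.mul_conj, Complex.normSq_eq_norm_sq, hc]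
  simp

/-- `(det (c·1))^q = c^{Nq}` for the scalar matrix `c·1 ∈ M_N(ℂ)`. -/
theorem det_zpow_smul_one (N : ℕ) (c : ℂ) (q : ℤ) :
    ((c • (1 : Matrix (Fin N) (Fin N) ℂ)).det) ^ q = c ^ ((N : ℤ) * q) := by
  rw [Matrix.det_smul, Matrix.det_one, mul_one, Fintype.card_fin, zpow_mul, zpow_natCast]

/-- **THE FLUX LOOPS OF TWO-DIMENSIONAL `U(N)` LATTICE YANG–MILLS OBEY THE VOLUME-UNIFORM AREA LAW.**  For every
`N ≥ 1`, every `q ≠ 0`, every continuous one-dimensional representation `σ` of `U(N)` with `σ(u) = (det u)^q`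
(`NonabelianAreaLaw2DFluxLoops.exists_continuous_detZPow_rep`) and every real `β`: there are `C` and `c_area > 0`
with `|⟨wilsonLoop σ⟩_{(ℤ/L)², β}| = |⟨Re (det W_{R×T})^q⟩| ≤ C^{2(R+T)} e^{−c_area RT}` for every torus size `L`,
both planes, every base point and all `1 ≤ R, T ≤ L/2`, the expectation being that of the `U(N)` Wilson action
`e^{−β Σ_p (N − Re tr U_p)}`. -/
theorem unitary_fluxLoop_areaLaw (N : ℕ) [NeZero N] {q : ℤ} (hq : q ≠ 0)
    (σ : Matrix.unitaryGroup (Fin N) ℂ →* Matrix (Fin 1) (Fin 1) ℂ) (hσc : Continuous σ)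
    (hσ : ∀ u, σ u 0 0 = (((u : Matrix.unitaryGroup (Fin N) ℂ) : Matrix (Fin N) (Fin N) ℂ).det) ^ q) (β : ℝ) :
    ∃ C c_area : ℝ, 0 < c_area ∧ ∀ (L : ℕ) [NeZero L] (x : Site 2 L) (i j : Fin 2) (R T : ℕ), i ≠ j →
      1 ≤ R → 1 ≤ T → 2 * R ≤ L → 2 * T ≤ L →
        |wilsonExpectation (unitaryFundamentalRep (Fin N) ℂ) β (wilsonLoop σ x i j R T)| ≤
          C ^ (2 * (R + T)) * Real.exp (-c_area * (R * T)) := by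
  -- the central witness `g₀ = e^{iπ/(Nq)}·1`, `σ(g₀) = (e^{iπ/(Nq)})^{Nq} = e^{iπ} = −1 ≠ 1`
  have hNq : (N : ℂ) * (q : ℂ) ≠ 0 :=
    mul_ne_zero (by exact_mod_cast NeZero.ne N) (by exact_mod_cast hq)
  set θ : ℂ := (Real.pi : ℂ) * Complex.I / ((N : ℂ) * (q : ℂ)) with hθ
  set c : ℂ := Complex.exp θ with hc_def
  have hc1 : ‖c‖ = 1 := by
    rw [hc_def, hθ, show (Real.pi : ℂ) * Complex.I / ((N : ℂ) * (q : ℂ)) =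
        ((Real.pi / ((N : ℝ) * (q : ℝ)) : ℝ) : ℂ) * Complex.I by push_cast; ring]
    exact Complex.norm_exp_ofReal_mul_I _
  set g₀ : Matrix.unitaryGroup (Fin N) ℂ := ⟨c • 1, smul_one_mem_unitaryGroup N hc1⟩ with hg₀
  have hdet : (((g₀ : Matrix.unitaryGroup (Fin N) ℂ) : Matrix (Fin N) (Fin N) ℂ).det) ^ q = -1 := by
    rw [hg₀]
    show ((c • (1 : Matrix (Fin N) (Fin N) ℂ)).det) ^ q = -1
    rw [det_zpow_smul_one, hc_def, ← Complex.exp_int_mul, hθ]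
    push_cast
    rw [mul_div_cancel₀ _ hNq, Complex.exp_pi_mul_I]
  have hne : σ g₀ ≠ 1 := by
    intro h
    have h00 := congrFun (congrFun h 0) 0
    rw [hσ, hdet, Matrix.one_apply_eq] at h00
    norm_num at h00
  exact areaLaw_two_of_rep_card_eq_one (unitaryFundamentalRep (Fin N) ℂ) σ
    (continuous_unitaryFundamentalRep (Fin N) ℂ) hσc ⟨g₀, hne⟩ β

end Summit.Ventures.LatticeQCDFlow.Scoring
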